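import Summits.BirchSwinnertonDyer.BirchSwinnertonDyer.Theorems.Rank2Observatory2DescClRealCertE2SQMain
import Summits.BirchSwinnertonDyer.BirchSwinnertonDyer.Theorems.ShaPrimaryTransferFiniteShaComponentTransferSelmerCubicDoorTransport
import HarnessLib

/-!
# BirchSwinnertonDyer — the SEL2CUBIC door for the two-view totally real host over a totally split `q` with an extra sieve conjunct: certificate ⟹ `t₂(E) = 0`, `Ш(E/ℚ)[2^∞] = 0`, `rank = r`

HONEST FRAMING: route `ShaPrimaryTransfer`, seat `bsd-line-spt-p1` (g32), `--supports` item T =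
`FiniteShaComponentTransfer` (stmt-22356), UNCHANGED (conjecture-grade at corank ≥ 2). BSD in rank ≥ 2 is NOT
proved by any of this. THEOREMS ONLY.

Selmer reading of the census theorem `TwoDescCl.rank_le_of_checkE3RX` (`Rank2Observatory2DescClRealCertE2SQMain`): two-view totally real host over a totally split `q` with an extra sieve conjunct (consumer: the E3N nodal rows).
Produced by the g30/g31 recipe (`…SelmerCubicRSRow`): the census proof verbatim, the extra conjunct's soundness hypothesis
`hextra` restated on `2`-SELMER classes (Cassels class `[a]`, `a·∏_{j∈U} W_j ∈ K^{×2}`), the sieve-soundness step through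
`admStd*_sound_sel` / `valRow_sound_sel`, the closing step through `natCard_selmerGroup_le_of_coverSet_cl` and
`sha_door_of_natCard_selmerGroup_two_le`:

* **`sha_door_of_checkE3RX`** — checker ∧ `hextra` on Selmer classes ∧ `r ≤ rank` ⟹ `t₂(E) = 0 ∧ Ш(E/ℚ)[2^∞] = 0 ∧ rank E(ℚ) = r`
  for the model `E = (0, A, 0, B, C)`. The nodal conjunct is discharged by `…SelmerCubicNodalSel`.
[cite: Cassels1991LecturesEllipticCurves, §15] [cite: SilvermanAEC2009, Thm. X.4.2, Rem. X.4.1] [cite: CremonaAlgorithms1997, §3.6]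
-/

-- single-conjunct summit: `Summit.BirchSwinnertonDyer.BirchSwinnertonDyer.…` repeats the name by design
set_option linter.dupNamespace false

noncomputable section

open scoped Classical NumberField nonZeroDivisors

open Literature.NumberTheory.NumberFields Literature.NumberTheory.EllipticCurves
  Literature.NumberTheory.GaloisRepresentations Polynomial Module NumberField IsDedekindDomain Ideal
open WeierstrassCurve WeierstrassCurve.Affine

namespace Summit.BirchSwinnertonDyer.BirchSwinnertonDyer.Theorems.ShaPrimaryTransferSelmerCubicCover

open Summit.BirchSwinnertonDyer.BirchSwinnertonDyer.Rank2Observatory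
open Summit.BirchSwinnertonDyer.BirchSwinnertonDyer.Rank2Observatory.TwoDescCubic
open Summit.BirchSwinnertonDyer.BirchSwinnertonDyer.Rank2Observatory.TwoDescCl
open Summit.BirchSwinnertonDyer.BirchSwinnertonDyer.Rank2Observatory.TwoDescCl.ClFieldCert
open Summit.BirchSwinnertonDyer.BirchSwinnertonDyer.Rank2Observatory.TwoDescCubic
open Summit.BirchSwinnertonDyer.BirchSwinnertonDyer.Rank2Observatory.TwoDescCl.ClFieldCert

section Row

variable {K : Type} [Field K] [NumberField K] {θ : K}

/-- **The SEL2CUBIC door for a `checkE3RX` row** with `extra` sound on `2`-Selmer classes: `t₂(E) = 0`,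
`Ш(E/ℚ)[2^∞] = 0`, `rank E(ℚ) = r`. [cite: Cassels1991LecturesEllipticCurves, §15]
[cite: SilvermanAEC2009, Thm. X.4.2, Rem. X.4.1] [cite: CremonaAlgorithms1997, §3.6] -/
theorem sha_door_of_checkE3RX (r : ℕ) (G : ClFieldCertRE2)
    (hθ : aeval θ (MonicCubic.poly G.toE2.fe.base.a G.toE2.fe.base.b G.toE2.fe.base.c) = 0)
    (h3 : finrank ℚ K = 3) (h2 : G.check2R3 = true) (hpr : G.toE2.fe.primeListE.Forall Nat.Prime)
    (ccr : ClCurveCertE3R) (hc : checkE3RCore G ccr = true)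
    (extra : Finset (Fin (fam3 ccr.cc).length) → Bool)
    [hEK : (((⟨0, ccr.cc.A, 0, ccr.cc.B, ccr.cc.C⟩ : WeierstrassCurve ℚ)).baseChange K).IsElliptic]
    (hextra : ∀ (e : 𝓞 K) (W : Fin (fam3 ccr.cc).length → 𝓞 K),
      (G.toE2.m₁ : 𝓞 K) * e = lin hθ ccr.cc.Xt.1 ccr.cc.Xt.2.1 ccr.cc.Xt.2.2 →
      (∀ j, (G.toE2.m₁ : 𝓞 K) * W j =
        lin hθ ((fam3 ccr.cc).get j).X.1 ((fam3 ccr.cc).get j).X.2.1 ((fam3 ccr.cc).get j).X.2.2) →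
      (∀ j, W j ≠ 0) → e ^ 3 + ccr.cc.A * e ^ 2 + ccr.cc.B * e + ccr.cc.C = 0 →
      ∀ (haev : aeval (algebraMap (𝓞 K) K e) (MonicCubic.poly ccr.cc.A ccr.cc.B ccr.cc.C) = 0),
      ∀ c ∈ selmerGroup ((⟨0, ccr.cc.A, 0, ccr.cc.B, ccr.cc.C⟩ : WeierstrassCurve ℚ)) 2, ∀ a : Kˣ,
        kummerEquiv K 2 (((⟨0, ccr.cc.A, 0, ccr.cc.B, ccr.cc.C⟩ : WeierstrassCurve ℚ)).oneRootDescentH1 K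
          (isTwoTorsionX_of_aeval (A := ccr.cc.A) (B := ccr.cc.B) (C := ccr.cc.C) ((⟨0, ccr.cc.A, 0, ccr.cc.B, ccr.cc.C⟩ : WeierstrassCurve ℚ)) rfl rfl rfl rfl rfl haev) c) =
          Additive.ofMul (QuotientGroup.mk a) →
      ∀ U : Finset (Fin (fam3 ccr.cc).length),
        IsSquare ((a : K) * ∏ j ∈ U, algebraMap (𝓞 K) K (W j)) → extra U = true)
    (hcount : ((Finset.univ ×ˢ Finset.univ).filter
      (fun p : Finset (Fin 0) × Finset (Fin (fam3 ccr.cc).length) =>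
        (admR3 G ccr p.1 p.2 && extra p.2) = true)).card ≤ 2 ^ r)
    (hlow : r ≤ ((⟨0, ccr.cc.A, 0, ccr.cc.B, ccr.cc.C⟩ : WeierstrassCurve ℚ)).mordellWeilRank) :
    ((⟨0, ccr.cc.A, 0, ccr.cc.B, ccr.cc.C⟩ : WeierstrassCurve ℚ)).shaCorank 2 = 0 ∧
      AddCommGroup.primaryComponent ((⟨0, ccr.cc.A, 0, ccr.cc.B, ccr.cc.C⟩ : WeierstrassCurve ℚ)).sha 2 = ⊥ ∧
        ((⟨0, ccr.cc.A, 0, ccr.cc.B, ccr.cc.C⟩ : WeierstrassCurve ℚ)).mordellWeilRank = r := by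
  classical
  have hK := G.const_of_check2R3 h2
  have harch := G.checkArch_of_check2R3 h2
  have hE := G.checkCoreE3_of_check2R3 h2
  have hR := G.toE2.fe.checkReg3_of_coreE3 hE
  have hprb := G.toE2.fe.base_primeList hpr
  have hirr := G.toE2.fe.base.irreducible_of_reg3 hR
  have h0 := G.fre.re.lo_nonneg_of_arch harch
  have hq := G.toE2.fe.base.q_prime hprb
  simp only [checkE3RCore, Bool.and_eq_true, decide_eq_true_eq, List.all_eq_true] at hc
  obtain ⟨⟨⟨⟨⟨⟨⟨⟨⟨⟨⟨⟨⟨⟨⟨⟨⟨⟨hΔ, hirrF⟩, hcub⟩, hder⟩, htvX⟩, htvD⟩, hdisc⟩, hND0⟩, hdn⟩, hdnC⟩, hcodes⟩, hdW0⟩,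
    hdW1⟩, hdW2⟩, hQ⟩, hhead⟩, hfamAll⟩, hord⟩, hcert⟩ := hc
  have hur : NumberField.Units.rank K = 2 :=
    units_rank_eq_two_of_disc_pos hirr hθ h3 (G.fre.re.disc_pos_of_arch harch)
  haveI hEl := isElliptic_of_deltaShort_ne hΔ
  have hirrF' := irreducible_of_noRootMod hirrF
  have hm₁K : (G.toE2.m₁ : K) ≠ 0 := m₁_ne_zero_K hK
  have hm₁O : (G.toE2.m₁ : 𝓞 K) ≠ 0 := m₁_ne_zero_O hK
  -- `θ_E = e₀`, root of `F`
  have hXe := m₁_mul_eltOf3_coe hθ hE hK htvX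
  have haevX := aeval_lin_eq_zero_of_coords hθ ccr.cc.Xt hcub
  have haev : aeval (algebraMap (𝓞 K) K (eltOf3 G.toE2 hθ hE ccr.cc.Xt ccr.cc.Yt)) (MonicCubic.poly ccr.cc.A ccr.cc.B ccr.cc.C) = 0 := by
    rw [← hXe] at haevX
    simp only [MonicCubic.poly, map_add, map_mul, map_pow, aeval_X, eq_intCast, map_intCast, map_natCast]
      at haevX ⊢
    have h3' : (G.toE2.m₁ : K) ^ 3 ≠ 0 := pow_ne_zero 3 hm₁K
    apply mul_right_injective₀ h3'
    simp only [mul_zero]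
    linear_combination haevX
  -- `D₀ = F′(e₀)`
  have hderX := deriv_eq_of_coords hθ ccr.cc.Xt (smulCoords (G.toE2.m₁ : ℤ) ccr.cc.XD) [] hder
  have hderiv : (3 : 𝓞 K) * (eltOf3 G.toE2 hθ hE ccr.cc.Xt ccr.cc.Yt) ^ 2 +
      2 * ((ccr.cc.A : ℤ) : 𝓞 K) * (eltOf3 G.toE2 hθ hE ccr.cc.Xt ccr.cc.Yt) + ((ccr.cc.B : ℤ) : 𝓞 K) = eltOf3 G.toE2 hθ hE ccr.cc.XD ccr.cc.YD := by
    rw [lin_smulCoords, ← m₁_mul_eltOf3 hθ hE hK htvX, ← m₁_mul_eltOf3 hθ hE hK htvD] at hderX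
    simp only [List.map_nil, List.prod_nil, mul_one, Int.cast_mul, Int.cast_pow, Int.cast_natCast] at hderX
    have h2' : (G.toE2.m₁ : 𝓞 K) ^ 2 ≠ 0 := pow_ne_zero 2 hm₁O
    apply mul_right_injective₀ h2'
    simp only
    linear_combination hderX
  have hD0 : eltOf3 G.toE2 hθ hE ccr.cc.XD ccr.cc.YD ≠ 0 := eltOf3_ne_zero hθ h3 hE hK htvD hND0
  have hq0 : ((G.toE2.fe.base.q : ℕ) : 𝓞 K) ≠ 0 := by exact_mod_cast hq.ne_zero
  have hM0 : eltOf3 G.toE2 hθ hE ccr.cc.XD ccr.cc.YD * ((G.toE2.fe.base.q : ℕ) : 𝓞 K) ≠ 0 := mul_ne_zero hD0 hq0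
  have hgen := closure_tsupp_eq_top_of_dvd
    (dvd_mul_left ((G.toE2.fe.base.q : ℕ) : 𝓞 K) (eltOf3 G.toE2 hθ hE ccr.cc.XD ccr.cc.YD)) (G.toE2.fe.closure_q_eq_top_of_coreE3 hθ h3 hE hpr)
  have hDM : ∀ v : HeightOneSpectrum (𝓞 K), (3 : 𝓞 K) * (eltOf3 G.toE2 hθ hE ccr.cc.Xt ccr.cc.Yt) ^ 2 +
      2 * ((ccr.cc.A : ℤ) : 𝓞 K) * (eltOf3 G.toE2 hθ hE ccr.cc.Xt ccr.cc.Yt) + ((ccr.cc.B : ℤ) : 𝓞 K) ∈ v.asIdeal →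
      eltOf3 G.toE2 hθ hE ccr.cc.XD ccr.cc.YD * ((G.toE2.fe.base.q : ℕ) : 𝓞 K) ∈ v.asIdeal := by
    intro v hv
    rw [hderiv] at hv
    exact Ideal.mul_mem_right _ _ hv
  -- `D₀ ∉ W_0, W_1, W_2` (read on `X_D`)
  have hXD_W : ∀ i, lin hθ ccr.cc.XD.1 ccr.cc.XD.2.1 ccr.cc.XD.2.2 ∉ (G.toE2.fe.base.WQ hθ h3 hR hprb i).asIdeal := by
    intro i
    fin_cases i
    · exact lin_not_mem_of_invCert hθ _ (WQ_asIdeal hθ h3 hR hprb 0) hdW0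
    · exact lin_not_mem_of_invCert hθ _ (WQ_asIdeal hθ h3 hR hprb 1) hdW1
    · exact lin_not_mem_of_invCert hθ _ (WQ_asIdeal hθ h3 hR hprb 2) hdW2
  have hDW : ∀ i, eltOf3 G.toE2 hθ hE ccr.cc.XD ccr.cc.YD ∉ (G.toE2.fe.base.WQ hθ h3 hR hprb i).asIdeal :=
    fun i h => hXD_W i (by rw [← m₁_mul_eltOf3 hθ hE hK htvD]; exact Ideal.mul_mem_left _ _ h)
  -- the support `T = {W_0, W_1, W_2} ∪ code primes`
  set L := ccr.cc.codes.length with hL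
  let Tf : Fin (L + 3) → HeightOneSpectrum (𝓞 K) := Matrix.vecCons (G.toE2.fe.base.WQ hθ h3 hR hprb 0)
    (Matrix.vecCons (G.toE2.fe.base.WQ hθ h3 hR hprb 1) (Matrix.vecCons (G.toE2.fe.base.WQ hθ h3 hR hprb 2)
      fun i => codePrime3 G.toE2 hθ h3 hE hpr (ccr.cc.codes.get i)))
  have hT : ∀ w : HeightOneSpectrum (𝓞 K),
      eltOf3 G.toE2 hθ hE ccr.cc.XD ccr.cc.YD * ((G.toE2.fe.base.q : ℕ) : 𝓞 K) ∈ w.asIdeal → ∃ i, Tf i = w := by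
    intro w hw
    have hqw : ((G.toE2.fe.base.q : ℕ) : 𝓞 K) ∈ w.asIdeal → ∃ i, Tf i = w := fun hqw => by
      obtain ⟨i, rfl⟩ := exists_eq_WQ hθ h3 hR hprb w hqw
      fin_cases i
      · exact ⟨0, by simp [Tf]⟩
      · exact ⟨1, by simp [Tf]⟩
      · exact ⟨2, by simp [Tf]⟩
    rcases w.isPrime.mem_or_mem hw with hD | hq'
    · obtain ⟨hXv, hYv⟩ := avatars_mem3 hθ hE hK htvD w hD
      obtain ⟨pe, hpe, hpv⟩ := exists_prime_of_mem3 hθ h3 hE hND0 hdn w hXv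
      rcases dispatch_sound3 (cc := ccr.cc) hθ h3 hE hK hpr (hdnC pe hpe) w hpv hXv hYv with
        hq'' | ⟨C, hmem, hany, hC, hw', -⟩ | ⟨C, hmem, hany, hC, hw', -⟩
      · exact hqw hq''
      · obtain ⟨bc, hbc, hbc1⟩ := List.mem_map.mp hmem
        obtain ⟨i, hi⟩ := List.mem_iff_get.mp hbc
        refine ⟨i.succ.succ.succ, HeightOneSpectrum.ext ?_⟩
        simp only [Tf, Matrix.cons_val_succ]
        rw [hi, codePrime3, if_pos (by rw [hbc1]), show bc.1.2 = C by rw [hbc1],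
          codePrimeR3_asIdeal hθ h3 hR hprb hany hC, hw']
      · obtain ⟨bc, hbc, hbc1⟩ := List.mem_map.mp hmem
        obtain ⟨i, hi⟩ := List.mem_iff_get.mp hbc
        refine ⟨i.succ.succ.succ, HeightOneSpectrum.ext ?_⟩
        simp only [Tf, Matrix.cons_val_succ]
        rw [hi, codePrime3, if_neg (by rw [hbc1]; exact Bool.false_ne_true), show bc.1.2 = C by rw [hbc1],
          ClFieldCertE.codePrimeEta3_asIdeal hθ h3 hE hpr hany hC, hw']
    · exact hqw hq'
  -- the family (`fam3 ccr.cc`, written out: the binders `extra`, `hextra`, `hcount` mention it)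
  let W : Fin (fam3 ccr.cc).length → 𝓞 K := fun j => eltOf3 G.toE2 hθ hE ((fam3 ccr.cc).get j).X ((fam3 ccr.cc).get j).Y
  have hfam : ∀ j : Fin (fam3 ccr.cc).length, famCheckE3R G ccr ((fam3 ccr.cc).get j) = true := fun j => hfamAll _ (List.get_mem _ j)
  have hfam1 : ∀ j : Fin (fam3 ccr.cc).length, famCheckE3 G.toE2 ccr.cc ((fam3 ccr.cc).get j) = true :=
    fun j => famCheckE3_of_famCheckE3R (hfam j)
  have hW0 : ∀ j, W j ≠ 0 := fun j =>
    eltOf3_ne_zero hθ h3 hE hK (tv_of_famCheckE3 (hfam1 j)) (normFormZ_ne_of_famCheckE3 (hfam1 j))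
  have hWval : ∀ j (v : HeightOneSpectrum (𝓞 K)),
      eltOf3 G.toE2 hθ hE ccr.cc.XD ccr.cc.YD * ((G.toE2.fe.base.q : ℕ) : 𝓞 K) ∉ v.asIdeal →
        v.valuation K (algebraMap (𝓞 K) K (W j)) = 1 :=
    fun j v hv => valuation_eq_one_of_support _ _ (supp_of_famCheckE3 hθ h3 hE hK hpr hcodes htvD (hfam1 j)) v hv
  obtain ⟨ρ, hρ⟩ := G.fre.re.exists_rho_of_arch3 hθ h3 hR harch
  have hsg : ∀ (k : Fin 3) (j : Fin (fam3 ccr.cc).length),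
      (sgAt3 ccr ((fam3 ccr.cc).get j) k = true ↔ ρ k (algebraMap (𝓞 K) K (W j)) < 0) :=
    fun k j => sgAt3_iff_of_famCheckE3R hθ ρ h0 hρ hE hK (hfam j) k
  have hρ0 : ∀ (k : Fin 3) (j : Fin (fam3 ccr.cc).length), ρ k (algebraMap (𝓞 K) K (W j)) ≠ 0 :=
    fun k j => rho_ne_zero_of_famCheckE3R hθ ρ h0 hρ hE hK (hfam j) k
  -- independence modulo squares: the parity certificate (rows computed on `X = m₁ x`, `m₁` a square)
  have hind : ∀ S : Finset (Fin (fam3 ccr.cc).length), IsSquare (∏ i ∈ S, algebraMap (𝓞 K) K (W i)) → S = ∅ := by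
    intro S hS
    refine indep_of_parity_certificate (fun i => algebraMap (𝓞 K) K (W i)) (bitR3 G ccr) ?_ hcert S hS
    intro k S' hS'
    have hS'' : IsSquare (∏ i ∈ S', W i) := isSquare_prod_of_isSquare_prod_coe _ hS'
    have hreal : ∀ kk : Fin 3,
        Even (S'.filter fun i => sgAt3 ccr ((fam3 ccr.cc).get i) kk = true).card := fun kk => by
      have h := even_card_of_isSquare_real (ρ kk) (fun i => algebraMap (𝓞 K) K (W i)) (fun i => hρ0 kk i) hS'
      convert h using 2
      exact Finset.filter_congr (fun i _ => hsg kk i)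
    obtain ⟨k, hk⟩ := k
    rcases k with _ | _ | _ | _ | _ | _ | k
    · simpa [bitR3, bitRowR3, sgAt3] using hreal 0
    · simpa [bitR3, bitRowR3, sgAt3] using hreal 1
    · simpa [bitR3, bitRowR3, sgAt3] using hreal 2
    · exact even_card_of_isSquare_valuation (G.toE2.fe.base.WQ hθ h3 hR hprb 0) W hW0 _
        (fun i => by
          show ((!decide ((2 : ℤ) ∣ famL3 0 ((fam3 ccr.cc).get i))) = true ↔ _)
          rw [log_WQ_of_famCheckE3 hθ h3 hE hK hpr (hfam1 i) 0]; simp) hS'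
    · exact even_card_of_isSquare_valuation (G.toE2.fe.base.WQ hθ h3 hR hprb 1) W hW0 _
        (fun i => by
          show ((!decide ((2 : ℤ) ∣ famL3 1 ((fam3 ccr.cc).get i))) = true ↔ _)
          rw [log_WQ_of_famCheckE3 hθ h3 hE hK hpr (hfam1 i) 1]; simp) hS'
    · exact even_card_of_isSquare_valuation (G.toE2.fe.base.WQ hθ h3 hR hprb 2) W hW0 _
        (fun i => by
          show ((!decide ((2 : ℤ) ∣ famL3 2 ((fam3 ccr.cc).get i))) = true ↔ _)
          rw [log_WQ_of_famCheckE3 hθ h3 hE hK hpr (hfam1 i) 2]; simp) hS'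
    · have hk' : k < G.toE2.fe.base.chars.length := by omega
      have hch : G.toE2.fe.base.chars.getD k ((3 : ℕ), (0 : ℤ), (0 : ℤ)) ∈ G.toE2.fe.base.chars := by
        rw [List.getD_eq_getElem?_getD, List.getElem?_eq_getElem hk', Option.getD_some]
        exact List.getElem_mem hk'
      obtain ⟨h2', ψ, hψ⟩ := G.toE2.fe.base.exists_psi_of_reg3 hθ h3 hR hprb hch
      haveI : Fact (G.toE2.fe.base.chars.getD k (3, 0, 0)).1.Prime := ⟨G.toE2.fe.base.char_prime hprb hch⟩
      have hSX : IsSquare (∏ i ∈ S', lin hθ ((fam3 ccr.cc).get i).X.1 ((fam3 ccr.cc).get i).X.2.1 ((fam3 ccr.cc).get i).X.2.2) := by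
        have e1 : ∀ i ∈ S', lin hθ ((fam3 ccr.cc).get i).X.1 ((fam3 ccr.cc).get i).X.2.1 ((fam3 ccr.cc).get i).X.2.2 = (G.toE2.m₁ : 𝓞 K) * W i :=
          fun i _ => (m₁_mul_eltOf3 hθ hE hK (tv_of_famCheckE3 (hfam1 i))).symm
        rw [Finset.prod_congr rfl e1, Finset.prod_mul_distrib, Finset.prod_const]
        obtain ⟨z, hz⟩ := hS''
        refine ⟨(G.toE2.r₁ : 𝓞 K) ^ S'.card * z, ?_⟩
        rw [hz]
        simp only [ClFieldCertE2.m₁, Nat.cast_pow]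
        ring
      have h := even_card_filter_eulerBit hθ (ℓ := (G.toE2.fe.base.chars.getD k (3, 0, 0)).1) (by omega) ψ hψ
        (fun i => ((fam3 ccr.cc).get i).X) (fun i => not_dvd_evalInt_of_famCheckE3 (hfam1 i) hch) hSX
      convert h using 2
      exact Finset.filter_congr (fun i _ => Iff.rfl)
  -- spanning of the `T`-units modulo squares
  have hodd : Odd (finrank ℚ K) := by rw [h3]; decide
  have hn : (fam3 ccr.cc).length = NumberField.Units.rank K + 1 + (L + 3) := by
    rw [hur]
    simp only [fam3, List.length_append, List.length_map, hL, hhead]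
    omega
  have hspan : ∀ u : K, u ≠ 0 →
      (∀ v : HeightOneSpectrum (𝓞 K),
        eltOf3 G.toE2 hθ hE ccr.cc.XD ccr.cc.YD * ((G.toE2.fe.base.q : ℕ) : 𝓞 K) ∉ v.asIdeal → v.valuation K u = 1) →
      ∃ U : Finset (Fin (fam3 ccr.cc).length), IsSquare (u * ∏ j ∈ U, algebraMap (𝓞 K) K (W j)) :=
    fun u hu huT => exists_isSquare_tunit_mul_prod hodd _ Tf hT hn (fun j => algebraMap (𝓞 K) K (W j))
      (fun j => RingOfIntegers.coe_ne_zero_iff.mpr (hW0 j)) hWval hind u hu huT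
  -- the sieve is sound at rational points
  have hFrel : (eltOf3 G.toE2 hθ hE ccr.cc.Xt ccr.cc.Yt) ^ 3 + ccr.cc.A * (eltOf3 G.toE2 hθ hE ccr.cc.Xt ccr.cc.Yt) ^ 2 +
      ccr.cc.B * (eltOf3 G.toE2 hθ hE ccr.cc.Xt ccr.cc.Yt) + ccr.cc.C = 0 := by
    apply RingOfIntegers.coe_injective
    simpa only [map_add, map_mul, map_pow, map_intCast, _root_.map_zero] using MonicCubic.theta_rel haev
  -- the `θ_E`-order of the places, read on `X_t = m₁·e₀` (`m₁ > 0`)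
  have hmR : (0 : ℝ) < G.toE2.m₁ := Nat.cast_pos.mpr (G.toE2.m₁_pos hK)
  have h12 : ρ ccr.o₀ (algebraMap (𝓞 K) K (eltOf3 G.toE2 hθ hE ccr.cc.Xt ccr.cc.Yt)) <
      ρ ccr.o₁ (algebraMap (𝓞 K) K (eltOf3 G.toE2 hθ hE ccr.cc.Xt ccr.cc.Yt)) := by
    have h := lin_lt_lin hθ (ρ ccr.o₀) (ρ ccr.o₁) (h0 _) (hρ _).1 (hρ _).2 (h0 _) (hρ _).1 (hρ _).2 _ _ _
      (of_decide_eq_true hord.1)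
    rw [rho_eltOf3 hθ hE hK htvX (ρ ccr.o₀), rho_eltOf3 hθ hE hK htvX (ρ ccr.o₁)] at h
    exact lt_of_mul_lt_mul_left h hmR.le
  have h23 : ρ ccr.o₁ (algebraMap (𝓞 K) K (eltOf3 G.toE2 hθ hE ccr.cc.Xt ccr.cc.Yt)) <
      ρ ccr.o₂ (algebraMap (𝓞 K) K (eltOf3 G.toE2 hθ hE ccr.cc.Xt ccr.cc.Yt)) := by
    have h := lin_lt_lin hθ (ρ ccr.o₁) (ρ ccr.o₂) (h0 _) (hρ _).1 (hρ _).2 (h0 _) (hρ _).1 (hρ _).2 _ _ _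
      (of_decide_eq_true hord.2)
    rw [rho_eltOf3 hθ hE hK htvX (ρ ccr.o₁), rho_eltOf3 hθ hE hK htvX (ρ ccr.o₂)] at h
    exact lt_of_mul_lt_mul_left h hmR.le
  have hadm : ∀ c ∈ selmerGroup ((⟨0, ccr.cc.A, 0, ccr.cc.B, ccr.cc.C⟩ : WeierstrassCurve ℚ)) 2, ∀ a : Kˣ,
      kummerEquiv K 2 (((⟨0, ccr.cc.A, 0, ccr.cc.B, ccr.cc.C⟩ : WeierstrassCurve ℚ)).oneRootDescentH1 K
        (isTwoTorsionX_of_aeval (A := ccr.cc.A) (B := ccr.cc.B) (C := ccr.cc.C) ((⟨0, ccr.cc.A, 0, ccr.cc.B, ccr.cc.C⟩ : WeierstrassCurve ℚ)) rfl rfl rfl rfl rfl haev) c) =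
        Additive.ofMul (QuotientGroup.mk a) →
      ∀ (T : Finset (Fin 0)) (U : Finset (Fin (fam3 ccr.cc).length)),
        IsSquare ((a : K) *
          (∏ i ∈ T, algebraMap (𝓞 K) K (((fun i : Fin 0 => i.elim0 : Fin 0 → (𝓞 K)ˣ) i : (𝓞 K)ˣ) : 𝓞 K)) *
            ∏ j ∈ U, algebraMap (𝓞 K) K (W j)) → (admR3 G ccr T U && extra U) = true := by
    intro c hc a ha T U hsq
    have hT0 : T = ∅ := Finset.eq_empty_of_isEmpty T
    have hxU : extra U = true := by
      refine hextra _ W (m₁_mul_eltOf3 hθ hE hK htvX) (fun j => m₁_mul_eltOf3 hθ hE hK (tv_of_famCheckE3 (hfam1 j)))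
        hW0 hFrel haev c hc a ha U ?_
      rw [hT0, Finset.prod_empty, mul_one] at hsq
      exact hsq
    have h1 : admStd3R (fun i : Fin 0 => i.elim0) (famNorm3 G.toE2 ccr.cc) (fun i : Fin 0 => i.elim0)
        (fun i : Fin 0 => i.elim0) (fun i : Fin 0 => i.elim0) (fun j => sgAt3 ccr ((fam3 ccr.cc).get j) ccr.o₀)
        (fun j => sgAt3 ccr ((fam3 ccr.cc).get j) ccr.o₁) (fun j => sgAt3 ccr ((fam3 ccr.cc).get j) ccr.o₂) T U = true :=
      admStd3R_sound_sel (A := ccr.cc.A) (B := ccr.cc.B) (C := ccr.cc.C) ((⟨0, ccr.cc.A, 0, ccr.cc.B, ccr.cc.C⟩ : WeierstrassCurve ℚ)) rfl rfl rfl rfl rfl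
        hirrF' haev h3 (ρ ccr.o₀) (ρ ccr.o₁) (ρ ccr.o₂) h12 h23
        (w := fun i : Fin 0 => algebraMap (𝓞 K) K
          (((fun i : Fin 0 => i.elim0 : Fin 0 → (𝓞 K)ˣ) i : (𝓞 K)ˣ) : 𝓞 K))
        (g := fun j => algebraMap (𝓞 K) K (W j)) (fun i => i.elim0)
        (fun j => RingOfIntegers.coe_ne_zero_iff.mpr (hW0 j)) (fun i => i.elim0)
        (fun j => norm_eltOf3 hθ h3 hE hK (tv_of_famCheckE3 (hfam1 j)) (dvd_of_famCheckE3 (hfam1 j)))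
        (fun i => i.elim0) (fun i => i.elim0) (fun i => i.elim0)
        (fun j => hsg _ j) (fun j => hsg _ j) (fun j => hsg _ j) hc a ha T U hsq
    have h2'' := valRow_sound_sel (A := ccr.cc.A) (B := ccr.cc.B) (C := ccr.cc.C) ((⟨0, ccr.cc.A, 0, ccr.cc.B, ccr.cc.C⟩ : WeierstrassCurve ℚ)) rfl rfl rfl rfl rfl haev
      (G.toE2.fe.base.WQ hθ h3 hR hprb 0) (by rw [hderiv]; exact hDW 0) hW0
      (r := fun j => bitRowR3 ccr G.toE2.fe.base ((fam3 ccr.cc).get j) 3) (fun j => by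
        show ((!decide ((2 : ℤ) ∣ famL3 0 ((fam3 ccr.cc).get j))) = true ↔ _)
        rw [show algebraMap (𝓞 K) K (W j) = ((W j : 𝓞 K) : K) from rfl,
          log_WQ_of_famCheckE3 hθ h3 hE hK hpr (hfam1 j) 0]; simp) hc a ha T U hsq
    have h3'' := valRow_sound_sel (A := ccr.cc.A) (B := ccr.cc.B) (C := ccr.cc.C) ((⟨0, ccr.cc.A, 0, ccr.cc.B, ccr.cc.C⟩ : WeierstrassCurve ℚ)) rfl rfl rfl rfl rfl haev
      (G.toE2.fe.base.WQ hθ h3 hR hprb 1) (by rw [hderiv]; exact hDW 1) hW0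
      (r := fun j => bitRowR3 ccr G.toE2.fe.base ((fam3 ccr.cc).get j) 4) (fun j => by
        show ((!decide ((2 : ℤ) ∣ famL3 1 ((fam3 ccr.cc).get j))) = true ↔ _)
        rw [show algebraMap (𝓞 K) K (W j) = ((W j : 𝓞 K) : K) from rfl,
          log_WQ_of_famCheckE3 hθ h3 hE hK hpr (hfam1 j) 1]; simp) hc a ha T U hsq
    have h4'' := valRow_sound_sel (A := ccr.cc.A) (B := ccr.cc.B) (C := ccr.cc.C) ((⟨0, ccr.cc.A, 0, ccr.cc.B, ccr.cc.C⟩ : WeierstrassCurve ℚ)) rfl rfl rfl rfl rfl haev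
      (G.toE2.fe.base.WQ hθ h3 hR hprb 2) (by rw [hderiv]; exact hDW 2) hW0
      (r := fun j => bitRowR3 ccr G.toE2.fe.base ((fam3 ccr.cc).get j) 5) (fun j => by
        show ((!decide ((2 : ℤ) ∣ famL3 2 ((fam3 ccr.cc).get j))) = true ↔ _)
        rw [show algebraMap (𝓞 K) K (W j) = ((W j : 𝓞 K) : K) from rfl,
          log_WQ_of_famCheckE3 hθ h3 hE hK hpr (hfam1 j) 2]; simp) hc a ha T U hsq
    rw [Bool.and_eq_true]
    refine ⟨?_, hxU⟩
    simp only [admR3, Bool.and_eq_true]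
    exact ⟨⟨⟨admStd3RQ_of_admStd3R hQ h1, h2''⟩, h3''⟩, h4''⟩
  have hsel := natCard_selmerGroup_le_of_coverSet_cl (A := ccr.cc.A) (B := ccr.cc.B) (C := ccr.cc.C)
    (⟨0, ccr.cc.A, 0, ccr.cc.B, ccr.cc.C⟩ : WeierstrassCurve ℚ) rfl rfl rfl rfl rfl hirrF' haev h3 hM0 hgen hDM hW0 hspan
    (Wu := fun i : Fin 0 => i.elim0) (adm := fun T U => admR3 G ccr T U && extra U) hadm
  exact sha_door_of_natCard_selmerGroup_two_le ((⟨0, ccr.cc.A, 0, ccr.cc.B, ccr.cc.C⟩ : WeierstrassCurve ℚ)) (hsel.trans hcount) hlow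

end Row

end Summit.BirchSwinnertonDyer.BirchSwinnertonDyer.Theorems.ShaPrimaryTransferSelmerCubicCover

end
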